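import Summits.ValiantsHypothesis.ValiantsHypothesis.Theorems.LacunarySymmetroidMatrixDescartesDoorA26WallBubblingThreeScaleTriple

/-!
# Wall bubbling for `DoorA26` — THE PURE-CLASS THREE-SCALE RULE OVER ABSTRACT FRAMES (for the three-pair chain)

HONEST FRAMING.  Obligation (W) `stub_weylFaces` of `Cruxes/DoorA26/Lines/wall_bubbling.lean` (crux `DoorA26`, stmt-ValiantsHypothesis-19979; OPEN,
typed, never asserted); W1 seat val-sym-door-p2 g14.  W2's rung `threeScale_triple` (door-p1 g14, `…ThreeScaleTriple`) is stated on the ONE-PAIR frame (if-chains with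
special positions `0,5`); W1 g13 re-framed it for two pairs at `(0,5)` and `(1,4)` (#48–#50b).  The three-pair chain (`ValueGenericThreePairChain26`,
OPEN) needs it for the three pure classes `2δ₀, 2δ₁, 2δ₂` of the THREE-PAIR frame.  Since W2's scalar core reads only the entries at positions
`0, 5`, the rule holds for ANY frames prescribed at those two positions — whatever they are elsewhere:

* **`pure_three_frames`** — frame equations `hF0, hF5` (and primed / indexed ones at the later scales), dominations / Gram-normalised limits for
  `polar (F ν a) (F ν b)`; conclusion `Γ₁ 0 5 ≠ 0 → Γ₂ 0 5 ≠ 0 → Γ₃ 0 5 ≠ 0 → False`.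

Three-pair (and two-pair) instances: relabel the letters (`U ∘ σ`, `δs ∘ σ`) so the pair sits at `(0,5)` and discharge the frame equations by
`simp` (port memo `HOME/val-sym-door-p2/g14/THREE-PAIR-CHAIN-PORT.md`).  Proof = W2's verbatim with the if-chain evaluations replaced by the frame
equations.  Registers unchanged; (W), `ValueGenericThreePairChain26`, `DoorA26` 19979, 18050 OPEN; nothing on VP ≠ VNP.  Def-free.
`--supports stmt-ValiantsHypothesis-19979 --as helper`.
-/

-- `Summit.ValiantsHypothesis.ValiantsHypothesis.…` repeats a component by the D-0017 layout
-- (single-conjunct summit), which the `dupNamespace` linter flags; the name is mandated.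
set_option linter.dupNamespace false

namespace Summit.ValiantsHypothesis.ValiantsHypothesis.Theorems.LacunarySymmetroidMatrixDescartes.WallBubbling

open Finset Filter Topology
open Bubbling (polar)
open scoped BigOperators

/-- **PURE-CLASS THREE-SCALE RULE OVER ABSTRACT FRAMES** (see the module docstring). [W2's rung 5, re-framed] -/
theorem pure_three_frames (δs : ℕ → Fin 6 → ℝ) (δ0 : Fin 6 → ℝ)
    (hδ : ∀ l, Tendsto (fun ν => δs ν l) atTop (𝓝 (δ0 l))) (h05 : δ0 5 = δ0 0)
    (U : ℕ → Fin 6 → Matrix (Fin 2) (Fin 2) ℝ) (F₁ F₂ F₃ : ℕ → Fin 6 → Matrix (Fin 2) (Fin 2) ℝ) (L₁ L₂ : ℕ → ℝ)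
    (hL₁ : Tendsto L₁ atTop atTop) (hL₂ : Tendsto L₂ atTop atTop)
    (hF₁0 : ∀ ν, F₁ ν 0 = U ν 0 + U ν 5) (hF₁5 : ∀ ν, F₁ ν 5 = (δs ν 5 - δs ν 0) • U ν 5)
    (hF₂0 : ∀ ν, F₂ ν 0 = Real.exp (δs ν 0 * L₁ ν) • U ν 0 + Real.exp (δs ν 5 * L₁ ν) • U ν 5)
    (hF₂5 : ∀ ν, F₂ ν 5 = (δs ν 5 - δs ν 0) • (Real.exp (δs ν 5 * L₁ ν) • U ν 5))
    (hF₃0 : ∀ ν, F₃ ν 0 = Real.exp (δs ν 0 * (L₁ ν + L₂ ν)) • U ν 0 + Real.exp (δs ν 5 * (L₁ ν + L₂ ν)) • U ν 5)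
    (hF₃5 : ∀ ν, F₃ ν 5 = (δs ν 5 - δs ν 0) • (Real.exp (δs ν 5 * (L₁ ν + L₂ ν)) • U ν 5))
    (μ₁ μ₂ μ₃ : ℕ → ℝ) (hμ₁ : ∀ ν, 0 < μ₁ ν) (hμ₂ : ∀ ν, 0 < μ₂ ν) (hμ₃ : ∀ ν, 0 < μ₃ ν)
    (hdom₁ : ∀ ν a b, |polar (F₁ ν a) (F₁ ν b)| ≤ μ₁ ν) (hdom₂ : ∀ ν a b, |polar (F₂ ν a) (F₂ ν b)| ≤ μ₂ ν)
    (hdom₃ : ∀ ν a b, |polar (F₃ ν a) (F₃ ν b)| ≤ μ₃ ν)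
    (Γ₁ Γ₂ Γ₃ : Fin 6 → Fin 6 → ℝ)
    (hΓ₁ : ∀ a b, Tendsto (fun ν => polar (F₁ ν a) (F₁ ν b) / μ₁ ν) atTop (𝓝 (Γ₁ a b)))
    (hΓ₂ : ∀ a b, Tendsto (fun ν => polar (F₂ ν a) (F₂ ν b) / μ₂ ν) atTop (𝓝 (Γ₂ a b)))
    (hΓ₃ : ∀ a b, Tendsto (fun ν => polar (F₃ ν a) (F₃ ν b) / μ₃ ν) atTop (𝓝 (Γ₃ a b)))
    (h1 : Γ₁ 0 5 ≠ 0) (h2 : Γ₂ 0 5 ≠ 0) (h3 : Γ₃ 0 5 ≠ 0) : False := by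
  set κ₁ : ℝ := |Γ₁ 0 5| / 2 with hκ₁
  set κ₂ : ℝ := |Γ₂ 0 5| / 2 with hκ₂
  set κ₃ : ℝ := |Γ₃ 0 5| / 2 with hκ₃
  have hκ₁pos : 0 < κ₁ := by rw [hκ₁]; exact half_pos (abs_pos.mpr h1)
  have hκ₂pos : 0 < κ₂ := by rw [hκ₂]; exact half_pos (abs_pos.mpr h2)
  have hκ₃pos : 0 < κ₃ := by rw [hκ₃]; exact half_pos (abs_pos.mpr h3)
  have hw0 : Tendsto (fun ν => δs ν 5 - δs ν 0) atTop (𝓝 0) := by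
    have := (hδ 5).sub (hδ 0)
    rw [h05, sub_self] at this
    exact this
  have hL₃ : Tendsto (fun ν => L₁ ν + L₂ ν) atTop atTop := hL₁.atTop_add_atTop hL₂
  -- aliveness at the three scales
  have e1 : ∀ᶠ ν in atTop, κ₁ * μ₁ ν ≤ |polar (U ν 0 + U ν 5) ((δs ν 5 - δs ν 0) • U ν 5)| := by
    have h := ((hΓ₁ 0 5).abs).eventually_const_lt (show κ₁ < |Γ₁ 0 5| by rw [hκ₁]; linarith [abs_pos.mpr h1])
    filter_upwards [h] with ν hν
    simp only [hF₁0 ν, hF₁5 ν] at hν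
    rw [abs_div, abs_of_pos (hμ₁ ν), lt_div_iff₀ (hμ₁ ν)] at hν
    exact hν.le
  have e2 : ∀ᶠ ν in atTop, κ₂ * μ₂ ν ≤ |polar (Real.exp (δs ν 0 * L₁ ν) • U ν 0 + Real.exp (δs ν 5 * L₁ ν) • U ν 5)
      ((δs ν 5 - δs ν 0) • (Real.exp (δs ν 5 * L₁ ν) • U ν 5))| := by
    have h := ((hΓ₂ 0 5).abs).eventually_const_lt (show κ₂ < |Γ₂ 0 5| by rw [hκ₂]; linarith [abs_pos.mpr h2])
    filter_upwards [h] with ν hν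
    simp only [hF₂0 ν, hF₂5 ν] at hν
    rw [abs_div, abs_of_pos (hμ₂ ν), lt_div_iff₀ (hμ₂ ν)] at hν
    exact hν.le
  have e3 : ∀ᶠ ν in atTop, κ₃ * μ₃ ν ≤ |polar (Real.exp (δs ν 0 * (L₁ ν + L₂ ν)) • U ν 0 + Real.exp (δs ν 5 * (L₁ ν + L₂ ν)) • U ν 5)
      ((δs ν 5 - δs ν 0) • (Real.exp (δs ν 5 * (L₁ ν + L₂ ν)) • U ν 5))| := by
    have h := ((hΓ₃ 0 5).abs).eventually_const_lt (show κ₃ < |Γ₃ 0 5| by rw [hκ₃]; linarith [abs_pos.mpr h3])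
    filter_upwards [h] with ν hν
    simp only [hF₃0 ν, hF₃5 ν] at hν
    rw [abs_div, abs_of_pos (hμ₃ ν), lt_div_iff₀ (hμ₃ ν)] at hν
    exact hν.le
  -- the six growth conditions on the transvection coefficients
  have g2a : ∀ᶠ ν in atTop, 0 * Real.exp ((δs ν 5 - δs ν 0) * L₁ ν) + 8 / κ₁
      < |dslope (fun y : ℝ => Real.exp (y * L₁ ν)) 0 (δs ν 5 - δs ν 0)| :=
    eventually_dslope_exp_gt (fun ν => δs ν 5 - δs ν 0) L₁ hw0 hL₁ 0 (8 / κ₁) le_rfl (by positivity)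
  have g2b : ∀ᶠ ν in atTop, 8 / κ₂ * Real.exp ((δs ν 5 - δs ν 0) * L₁ ν) + 0
      < |dslope (fun y : ℝ => Real.exp (y * L₁ ν)) 0 (δs ν 5 - δs ν 0)| :=
    eventually_dslope_exp_gt (fun ν => δs ν 5 - δs ν 0) L₁ hw0 hL₁ (8 / κ₂) 0 (by positivity) le_rfl
  have g3a : ∀ᶠ ν in atTop, 0 * Real.exp ((δs ν 5 - δs ν 0) * (L₁ ν + L₂ ν)) + 8 / κ₁
      < |dslope (fun y : ℝ => Real.exp (y * (L₁ ν + L₂ ν))) 0 (δs ν 5 - δs ν 0)| :=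
    eventually_dslope_exp_gt (fun ν => δs ν 5 - δs ν 0) (fun ν => L₁ ν + L₂ ν) hw0 hL₃ 0 (8 / κ₁) le_rfl (by positivity)
  have g3b : ∀ᶠ ν in atTop, 8 / κ₃ * Real.exp ((δs ν 5 - δs ν 0) * (L₁ ν + L₂ ν)) + 0
      < |dslope (fun y : ℝ => Real.exp (y * (L₁ ν + L₂ ν))) 0 (δs ν 5 - δs ν 0)| :=
    eventually_dslope_exp_gt (fun ν => δs ν 5 - δs ν 0) (fun ν => L₁ ν + L₂ ν) hw0 hL₃ (8 / κ₃) 0 (by positivity) le_rfl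
  have gDa : ∀ᶠ ν in atTop, 0 * Real.exp ((δs ν 5 - δs ν 0) * L₂ ν) + 8 / κ₂
      < |dslope (fun y : ℝ => Real.exp (y * L₂ ν)) 0 (δs ν 5 - δs ν 0)| :=
    eventually_dslope_exp_gt (fun ν => δs ν 5 - δs ν 0) L₂ hw0 hL₂ 0 (8 / κ₂) le_rfl (by positivity)
  have gDb : ∀ᶠ ν in atTop, 8 / κ₃ * Real.exp ((δs ν 5 - δs ν 0) * L₂ ν) + 0
      < |dslope (fun y : ℝ => Real.exp (y * L₂ ν)) 0 (δs ν 5 - δs ν 0)| :=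
    eventually_dslope_exp_gt (fun ν => δs ν 5 - δs ν 0) L₂ hw0 hL₂ (8 / κ₃) 0 (by positivity) le_rfl
  have hfalse : ∀ᶠ ν : ℕ in atTop, False := by
    filter_upwards [e1, e2, e3, g2a, g2b, g3a, g3b, gDa, gDb] with ν hν1 hν2 hν3 q2a q2b q3a q3b qDa qDb
    obtain ⟨-, i05₂, i00₂⟩ := triple_frameShift (δs ν) (U ν) (L₁ ν)
    obtain ⟨-, i05₃, i00₃⟩ := triple_frameShift (δs ν) (U ν) (L₁ ν + L₂ ν)
    set w := δs ν 5 - δs ν 0 with hw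
    set g55 := polar (w • U ν 5) (w • U ν 5) with hg55
    set g05 := polar (U ν 0 + U ν 5) (w • U ν 5) with hg05
    set g00 := polar (U ν 0 + U ν 5) (U ν 0 + U ν 5) with hg00
    set Λ₂ := dslope (fun y : ℝ => Real.exp (y * L₁ ν)) 0 w with hΛ₂
    set Λ₃ := dslope (fun y : ℝ => Real.exp (y * (L₁ ν + L₂ ν))) 0 w with hΛ₃
    set D := dslope (fun y : ℝ => Real.exp (y * L₂ ν)) 0 w with hD
    set E₂ := Real.exp (δs ν 0 * L₁ ν) with hE₂
    set E₃ := Real.exp (δs ν 0 * (L₁ ν + L₂ ν)) with hE₃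
    set e₂ := Real.exp (w * L₁ ν) with he₂
    set e₃ := Real.exp (w * (L₁ ν + L₂ ν)) with he₃
    set d := Real.exp (w * L₂ ν) with hd
    have hE₂pos : 0 < E₂ := Real.exp_pos _
    have hE₃pos : 0 < E₃ := Real.exp_pos _
    have he₂pos : 0 < e₂ := Real.exp_pos _
    have he₃pos : 0 < e₃ := Real.exp_pos _
    have hdpos : 0 < d := Real.exp_pos _
    have h00le : |g00| ≤ μ₁ ν := by have := hdom₁ ν 0 0; simp only [hF₁0 ν] at this; exact this
    -- cluster 2: κ₂ |g00^{(2)}| ≤ |g05^{(2)}|, with the E² factors divided out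
    have c2 : κ₂ * |g00 + 2 * Λ₂ * g05 + Λ₂ * Λ₂ * g55| ≤ e₂ * |g05 + Λ₂ * g55| := by
      have hd00 := hdom₂ ν 0 0
      simp only [hF₂0 ν] at hd00
      rw [i00₂, abs_mul, abs_of_pos (mul_pos hE₂pos hE₂pos)] at hd00
      rw [i05₂, abs_mul, abs_of_pos (by positivity)] at hν2
      have : (κ₂ * |g00 + 2 * Λ₂ * g05 + Λ₂ * Λ₂ * g55|) * (E₂ * E₂) ≤ (e₂ * |g05 + Λ₂ * g55|) * (E₂ * E₂) := by
        calc (κ₂ * |g00 + 2 * Λ₂ * g05 + Λ₂ * Λ₂ * g55|) * (E₂ * E₂) = κ₂ * (E₂ * E₂ * |g00 + 2 * Λ₂ * g05 + Λ₂ * Λ₂ * g55|) := by ring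
          _ ≤ κ₂ * μ₂ ν := mul_le_mul_of_nonneg_left hd00 hκ₂pos.le
          _ ≤ E₂ * E₂ * e₂ * |g05 + Λ₂ * g55| := hν2
          _ = (e₂ * |g05 + Λ₂ * g55|) * (E₂ * E₂) := by ring
      exact le_of_mul_le_mul_right this (by positivity)
    have c3 : κ₃ * |g00 + 2 * Λ₃ * g05 + Λ₃ * Λ₃ * g55| ≤ e₃ * |g05 + Λ₃ * g55| := by
      have hd00 := hdom₃ ν 0 0
      simp only [hF₃0 ν] at hd00
      rw [i00₃, abs_mul, abs_of_pos (mul_pos hE₃pos hE₃pos)] at hd00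
      rw [i05₃, abs_mul, abs_of_pos (by positivity)] at hν3
      have : (κ₃ * |g00 + 2 * Λ₃ * g05 + Λ₃ * Λ₃ * g55|) * (E₃ * E₃) ≤ (e₃ * |g05 + Λ₃ * g55|) * (E₃ * E₃) := by
        calc (κ₃ * |g00 + 2 * Λ₃ * g05 + Λ₃ * Λ₃ * g55|) * (E₃ * E₃) = κ₃ * (E₃ * E₃ * |g00 + 2 * Λ₃ * g05 + Λ₃ * Λ₃ * g55|) := by ring
          _ ≤ κ₃ * μ₃ ν := mul_le_mul_of_nonneg_left hd00 hκ₃pos.le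
          _ ≤ E₃ * E₃ * e₃ * |g05 + Λ₃ * g55| := hν3
          _ = (e₃ * |g05 + Λ₃ * g55|) * (E₃ * E₃) := by ring
      exact le_of_mul_le_mul_right this (by positivity)
    -- the nested-shift identity and `e₃ = e₂ d`
    have hDrel : Λ₃ - Λ₂ = e₂ * D := dslope_exp_shift_sub (L₁ ν) (L₂ ν) w
    have he₃eq : e₃ = e₂ * d := by rw [he₃, he₂, hd, ← Real.exp_add]; congr 1; ring
    -- growth bounds in the form the core wants
    rw [zero_mul, zero_add] at q2a q3a qDa
    rw [add_zero] at q2b q3b qDb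
    have b2a : 8 ≤ κ₁ * |Λ₂| := by
      have := mul_le_mul_of_nonneg_left q2a.le hκ₁pos.le
      rw [show κ₁ * (8 / κ₁) = 8 by field_simp] at this; exact this
    have b2b : 8 * e₂ ≤ κ₂ * |Λ₂| := by
      have := mul_le_mul_of_nonneg_left q2b.le hκ₂pos.le
      rw [show κ₂ * (8 / κ₂ * e₂) = 8 * e₂ by field_simp] at this; exact this
    have b3a : 8 ≤ κ₁ * |Λ₃| := by
      have := mul_le_mul_of_nonneg_left q3a.le hκ₁pos.le
      rw [show κ₁ * (8 / κ₁) = 8 by field_simp] at this; exact this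
    have b3b : 8 * e₃ ≤ κ₃ * |Λ₃| := by
      have := mul_le_mul_of_nonneg_left q3b.le hκ₃pos.le
      rw [show κ₃ * (8 / κ₃ * e₃) = 8 * e₃ by field_simp] at this; exact this
    have bDa : 8 * e₂ ≤ κ₂ * |e₂ * D| := by
      have h8 := mul_le_mul_of_nonneg_left qDa.le hκ₂pos.le
      rw [show κ₂ * (8 / κ₂) = 8 by field_simp] at h8
      rw [abs_mul, abs_of_pos he₂pos]
      calc 8 * e₂ = e₂ * 8 := by ring
        _ ≤ e₂ * (κ₂ * |D|) := mul_le_mul_of_nonneg_left h8 he₂pos.le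
        _ = κ₂ * (e₂ * |D|) := by ring
    have bDb : 8 * e₃ ≤ κ₃ * |e₂ * D| := by
      have h8 := mul_le_mul_of_nonneg_left qDb.le hκ₃pos.le
      rw [show κ₃ * (8 / κ₃ * d) = 8 * d by field_simp] at h8
      rw [abs_mul, abs_of_pos he₂pos, he₃eq]
      calc 8 * (e₂ * d) = e₂ * (8 * d) := by ring
        _ ≤ e₂ * (κ₃ * |D|) := mul_le_mul_of_nonneg_left h8 he₂pos.le
        _ = κ₃ * (e₂ * |D|) := by ring
    exact three_opposite_core hκ₁pos hκ₂pos hκ₃pos (hμ₁ ν) he₂pos hν1 h00le c2 c3 hDrel b2a b2b b3a b3b bDa bDb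
  exact hfalse.exists.elim fun _ h => h


end Summit.ValiantsHypothesis.ValiantsHypothesis.Theorems.LacunarySymmetroidMatrixDescartes.WallBubbling
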